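import Summits.QuantumFields.YangMills.Theses.SqueezedSkewness

/-!
# Birth skeleton — LINE χ₂ «femto currency» on `FemtoFloorUnit` (stmt-QuantumFields-23545)
# (planner ym-idea-6 g12, lens oqh; route-QuantumFields-SqueezedSkewness rev 20)

THE SPLIT.  `FemtoFloorUnit` (LINE χ's crux: a unit carrying the spine's `FBL6` and femto window floors for bumps of
every radius) ⇐ `FemtoTwoPointUnit` (crux XL, item 23679: ∃ unit with the spine's `DlrCollarTransfer.FBL6 ∧ FC2` BY
NAME — the output of the spine's `stub_fcp6` with the three-point clause `FC3` dropped; ONE staffed currency with the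
spine) + `CollarBumpFloors` (support L, item 23680: in any unit, `FBL6 ∧ FC2 ⇒` the window floors — the landed
`lowerBounds_twoPoint_weak` / `floor_of_fc2` of Theorems/BalabanLadderNTWeakPackage.lean with radius and height as
parameters: torus DLR + law of total covariance on one femto cube containing the bump and its mirror, `Γ(s)/s⁸ → ∞`
beats the boundary term `2(C₁/d⁴)²` uniformly on the height window, electric seam `O(a/ρ*)` relative by
`FBL6 ⇒ MomentBounds6` (landed `stub_collar6`)).  The composition `FemtoFloorUnit_of` is KERNEL-CHECKED and is the
content of the route's glue item `FemtoCurrencyGlue` (23681).  Sorries: exactly the two stubs.  No NT / summit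
statement is proved here. [folklore]
-/

set_option autoImplicit false

noncomputable section

namespace Summit.QuantumFields.YangMills.Cruxes.NT.FemtoCurrencyBirth

namespace __Registered

/-- = `SqueezedSkewness.FemtoTwoPointUnit` (stmt-QuantumFields-23679, crux XL) BY NAME. -/
abbrev stub_femtoTwoPointUnit : Prop :=
  Summit.QuantumFields.YangMills.Theses.SqueezedSkewness.FemtoTwoPointUnit

/-- = `SqueezedSkewness.CollarBumpFloors` (stmt-QuantumFields-23680, support L) BY NAME. -/
abbrev stub_collarBumpFloors : Prop :=
  Summit.QuantumFields.YangMills.Theses.SqueezedSkewness.CollarBumpFloors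

end __Registered

/-- stub (crux XL — the hardest; engine-grade, shared currency with the spine's `stub_fcp6`): FEMTO TWO-POINT UNIT. OPEN. -/
theorem stub_femtoTwoPointUnit : __Registered.stub_femtoTwoPointUnit := by
  sorry

/-- stub (support L): COLLAR BUMP FLOORS — `FBL6 ∧ FC2 ⇒` femto window floors for bumps of every radius. OPEN. -/
theorem stub_collarBumpFloors : __Registered.stub_collarBumpFloors := by
  sorry

/-- LINE χ₂ composition (kernel-checked) = route item `FemtoCurrencyGlue` (23681). -/
theorem FemtoFloorUnit_of (h1 : __Registered.stub_femtoTwoPointUnit)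
    (h2 : __Registered.stub_collarBumpFloors) :
    Summit.QuantumFields.YangMills.Theses.SqueezedSkewness.FemtoFloorUnit := by
  intro G _ _ _ _ hG
  obtain ⟨r, a, hpos, hlim, h6, h2'⟩ := h1 G hG
  refine ⟨r, a, ?_⟩
  exact ⟨hpos, hlim, h6, h2 G hG r a hpos hlim h6 h2'⟩

/-- The glue item itself, by name (kernel-checked): `FemtoTwoPointUnit → CollarBumpFloors → FemtoFloorUnit`. -/
theorem femtoCurrencyGlue_term : Summit.QuantumFields.YangMills.Theses.SqueezedSkewness.FemtoCurrencyGlue :=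
  fun h1 h2 => FemtoFloorUnit_of h1 h2

end Summit.QuantumFields.YangMills.Cruxes.NT.FemtoCurrencyBirth
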